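import Summits.ResolutionOfSingularities.ResolutionOfSingularities.Theorems.FrobeniusClosingPatchingRelPerfectDepthPhaseCLocalGamePieces
import Summits.ResolutionOfSingularities.ResolutionOfSingularities.Theorems.FrobeniusClosingPatchingRelPerfectDepthPhaseCLocalGamePatchReductionEnd
import Literature.AlgebraicGeometry.Resolution.KollarFunctorComposition
import HarnessLib

/-!
# [OURS · L1 W5.2 · (β-AX) X3 C-I (G-T) (iv″/iv‴)] Sequential patching, III: END ORDER REDUCTION FOR PIECEWISE-PRESENTED TOP LOCI

Sub-problem `ResolutionOfSingularities`, crux `PatchingRelPerfect` (stmt-ResolutionOfSingularities-16161), line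
`Cruxes/PatchingRelPerfect/Lines/closed_point_slice.lean`, engine (G2), Prop `X3LemmaM.EndOrderReduction m` of `…DepthPhaseCX3Defs`.

Part III supplies the one-patch CURE SCHEMA of `endOrderReduction_of_closedPieces` (part II) from a monomial PRESENTATION on an open
containing the piece — res-D-pv-046's one-patch engine `MonomialCleanup.monomialPatchOrderReduction` (Route K's win through the
marking-`m` dictionary) run on the presentation open, its accumulated exceptional monomial recomputed WITH ITS COSUPPORT (§1), and the
factorization package pushed to the whole patch by `exists_factorization_extend` (part I) — and concludes the user-facing statement:

* §1 `exists_isEffectiveCartier_mul_transformMarked_ideal_of_centresOver` — `Π^*𝓘 = 𝓔 · 𝓘_r`, `𝓔` effective Cartier AND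
  cosupported over any closed set the centres lie over (the recursion of `CarrierGoingUp.exists_isEffectiveCartier_mul_transformMarked_ideal`).
* §2 `pointedDistinct_map_comap_of_flat` — pointed-distinct snc letters stay pointed-distinct after flat pull-back.
* §3 `endOrderReduction_cure_of_presentation` — the cure schema on a patch from a presentation on an open of the patch.
* §4 **`endOrderReduction_of_piecewisePresented`** — the conclusion of `EndOrderReduction m` for every locally-END `K` whose top locus
  `singGE K m` is a finite disjoint union of closed pieces each inside ONE presentation open (Bierstone–Milman's sequential gluing
  [BM 2006, Lemma 8.7; Thm. 8.5 Step 1], the (H-pt) interim partial of record, res-D-pv-046 ENGINE NOTE 4 CLAIM 2).  The residual case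
  (iii′) — a piece inside no single presentation open — is not treated.

## References
* E. Bierstone, P. Milman, *Desingularization of toric and binomial varieties*, J. Algebraic Geom. 15 (2006), arXiv:math/0411340,
  Lemma 8.7; proof of Thm. 8.5, Step 1. [BierstoneMilman2006]
* J. Kollár, *Lectures on Resolution of Singularities* (2007), 3.72, (3.111) Step 3. [Kollar2007]
* E. Bierstone, D. Grigoriev, P. Milman, J. Włodarczyk, arXiv:1206.3090, Lemma 3.2.1, Thm. 8.0.5. [BierstoneGrigorievMilmanWlodarczyk2011]
* U. Görtz, T. Wedhorn, *Algebraic Geometry I* (2nd ed. 2020), Prop. 13.91. [GortzWedhorn2020]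
-/

-- `Summit.<Summit>.<Sub>.Theorems` with `Sub = Summit` (single-conjunct summit, D-0017)
set_option linter.dupNamespace false

noncomputable section

namespace Summit.ResolutionOfSingularities.ResolutionOfSingularities.Theorems.X3LemmaM

open CategoryTheory AlgebraicGeometry TopologicalSpace IsLocalRing
open Literature.AlgebraicGeometry.Resolution
open Scheme.IdealSheafData
open DepthTargets (monomialSum)
open MonomialCleanup (PointedDistinct nthSheaf monomialPatchOrderReduction)

universe u

variable {X : Scheme.{u}}

/-! ## §1 The accumulated exceptional monomial, with its cosupport -/

/-- **`Π^* 𝓘 = 𝓔 · 𝓘_r` with `𝓔` effective Cartier and cosupported over `T`** along any admissible sequence for `M = (𝓘, E, μ)`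
whose centres lie over `T` (locally Noetherian `X`): stage by stage `π^* 𝓘_i = 𝓘(D)^μ · 𝓘_{i+1}` (`MarkedIdeal.pow_mul_transform_ideal`),
the exceptional divisors pull back to effective Cartier divisors up the tower (`IsEffectiveCartier.comap_centreSeqComp`), and their
cosupports are the preimages of the centres. [cite: Kollar2007, 3.72] [cite: BierstoneGrigorievMilmanWlodarczyk2011, Lemma 3.2.1] -/
theorem exists_isEffectiveCartier_mul_transformMarked_ideal_of_centresOver :
    ∀ {X : Scheme.{u}} [IsLocallyNoetherian X] (s : CentreSeq X) (M : MarkedIdeal X) (T : Set X), s.IsAdmissibleFor M →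
      s.CentresOver T →
      ∃ E : s.top.IdealSheafData, IsEffectiveCartier E ∧ (E.support : Set s.top) ⊆ s.comp.base ⁻¹' T ∧
        M.ideal.comap s.comp = E * (s.transformMarked M).ideal
  | X, _, CentreSeq.nil _, M, T, _, _ =>
    ⟨⊤, isEffectiveCartier_top, fun x hx => by
      rw [Scheme.IdealSheafData.support_top, TopologicalSpace.Closeds.coe_bot] at hx
      exact hx.elim, by
      show M.ideal.comap (𝟙 X) = ⊤ * M.ideal
      rw [Scheme.IdealSheafData.comap_id, Scheme.IdealSheafData.top_mul]⟩
  | X, _, CentreSeq.cons C rest, M, T, hadm, hover => by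
    obtain ⟨hsupp, hsnc, -, hrest⟩ := hadm
    obtain ⟨hCT, hrestT⟩ := hover
    haveI : IsLocallyNoetherian (blowup C) := CentreSeq.isLocallyNoetherian_blowup C
    obtain ⟨E, hE, hET, hEq⟩ :=
      exists_isEffectiveCartier_mul_transformMarked_ideal_of_centresOver rest _ _ hrest hrestT
    refine ⟨((C.comap (blowup.π C)) ^ M.mult).comap rest.comp * E,
      (((blowup.isBlowup C).isEffectiveCartier.pow M.mult).comap_centreSeqComp rest).mul hE, ?_, ?_⟩
    · intro y hy
      change (rest.comp ≫ blowup.π C).base y ∈ T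
      rw [Scheme.Hom.comp_apply]
      have hy' : y ∈ ((((C.comap (blowup.π C)) ^ M.mult).comap rest.comp * E).support : Set rest.top) := hy
      rw [Scheme.IdealSheafData.support_mul, TopologicalSpace.Closeds.coe_sup] at hy'
      rcases hy' with h | h
      · have h' := (mem_support_comap_iff rest.comp _ y).mp h
        by_cases hμ : M.mult = 0
        · rw [hμ, pow_zero, Scheme.IdealSheafData.one_eq_top, Scheme.IdealSheafData.support_top,
            TopologicalSpace.Closeds.coe_bot] at h'
          exact h'.elim
        · rw [Scheme.IdealSheafData.support_pow _ _ hμ] at h'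
          exact hCT ((mem_support_comap_iff (blowup.π C) C _).mp h')
      · exact hET h
    · show M.ideal.comap (rest.comp ≫ blowup.π C) =
        ((C.comap (blowup.π C)) ^ M.mult).comap rest.comp * E * (rest.transformMarked (M.transform (blowup.π C) C)).ideal
      rw [Scheme.IdealSheafData.comap_comp, ← M.pow_mul_transform_ideal (blowup.π C) hsupp hsnc (blowup.isBlowup C),
        comap_mul, hEq, mul_assoc]

/-! ## §2 Pointed-distinct letters pull back -/

/-- **Pointed-distinct snc letters stay pointed-distinct after pull-back along a flat morphism** (two distinct snc letters with the
same pull-back pull back to the empty divisor, `HasSNC.comap_eq_top_of_ne_of_flat`). [cite: Kollar2007, Notation 3.64 (3)] -/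
theorem pointedDistinct_map_comap_of_flat {Y : Scheme.{u}} (f : Y ⟶ X) [Flat f] {Es : List X.IdealSheafData} (hEs : HasSNC Es)
    (hpd : PointedDistinct Es) : PointedDistinct (Es.map (·.comap f)) := by
  intro k k' hk hk' hne y hy hy' heq
  rw [List.length_map] at hk hk'
  simp only [MonomialCleanup.nthSheaf_map Es _ hk, MonomialCleanup.nthSheaf_map Es _ hk'] at heq hy hy'
  have hx : f.base y ∈ (nthSheaf Es k).support := by
    rw [Scheme.IdealSheafData.support_comap] at hy; exact hy
  have hx' : f.base y ∈ (nthSheaf Es k').support := by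
    rw [Scheme.IdealSheafData.support_comap] at hy'; exact hy'
  have hne' := hpd k k' hk hk' hne (f.base y) hx hx'
  have htop := HasSNC.comap_eq_top_of_ne_of_flat f hEs (MonomialCleanup.nthSheaf_mem hk) (MonomialCleanup.nthSheaf_mem hk')
    hne' heq
  rw [htop, Scheme.IdealSheafData.support_top] at hy
  have hy₀ : y ∈ ((⊥ : Closeds Y) : Set Y) := hy
  rw [TopologicalSpace.Closeds.coe_bot] at hy₀
  exact hy₀.elim

/-! ## §3 The cure schema from a presentation on an open of the patch -/

/-- [OURS · L1 W5.2 · (iv″)] **THE ONE-PATCH CURE FROM A PRESENTATION.**  `Y` Noetherian regular, `K` locally END on its cosupport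
(letters `𝓛`), `m ≥ 1`, `Z ⊇ singGE K m` closed and contained in the open `Y₀`, on which `K|_{Y₀} = Σ 𝒦` is a monomial sum over snc
pointed-distinct letters `Es`.  THEN: a blow-up sequence of `Y` with regular centres over `Z` and regular top, and a factorization
`K·𝒪 = M · K₁` with `M` effective Cartier cosupported over `Z`, `ord K₁ < m` everywhere and `K₁` locally END on its whole cosupport.
(res-D-pv-046's `monomialPatchOrderReduction` on `Y₀`; §1 for the cosupport of `M`; `exists_factorization_extend` along `Y₀ ↪ Y`.)
[cite: BierstoneMilman2006, Lemma 8.7] [cite: Kollar2007, (3.111) Step 3] [cite: GortzWedhorn2020, Prop. 13.91 (1)–(3)] -/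
theorem endOrderReduction_cure_of_presentation {Y : Scheme.{u}} [IsNoetherian Y] (hY : Scheme.IsRegular Y)
    (K : Y.IdealSheafData) (𝓛 : List Y.IdealSheafData) (hend : ∀ y ∈ (K.support : Set Y), IsEndNear K 𝓛 y)
    {m : ℕ} (hm : 1 ≤ m) {Z : Set Y} (hZ : IsClosed Z) (hSZ : singGE K m ⊆ Z) (Y₀ : Y.Opens) (hZY₀ : Z ⊆ (Y₀ : Set Y))
    (Es : List (Y₀ : Scheme.{u}).IdealSheafData) (hEs : HasSNC Es) (hpd : PointedDistinct Es)
    (𝒦 : List (List ((Y₀ : Scheme.{u}).IdealSheafData × ℕ))) (hbd : ∀ A ∈ 𝒦, boundaryOf A = Es) (h𝒦 : 𝒦 ≠ [])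
    (hK : K.comap Y₀.ι = monomialSum 𝒦) :
    ∃ s : CentreSeq Y, s.AllRegular ∧ s.CentresOver Z ∧ Scheme.IsRegular s.top ∧
      ∃ (M K₁ : s.top.IdealSheafData) (𝓛' : List s.top.IdealSheafData),
        K.comap s.comp = M * K₁ ∧ IsEffectiveCartier M ∧ (M.support : Set s.top) ⊆ s.comp.base ⁻¹' Z ∧
        (∀ y, idealOrder K₁ y < m) ∧ (∀ y ∈ (K₁.support : Set s.top), IsEndNear K₁ 𝓛' y) := by
  haveI : CompactSpace (Y₀ : Scheme.{u}) :=
    isCompact_iff_compactSpace.mp (TopologicalSpace.NoetherianSpace.isCompact (Y₀ : Set Y))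
  haveI : IsNoetherian (Y₀ : Scheme.{u}) := ⟨⟩
  obtain ⟨t, hadm, -, hsupp, hsnc', ⟨𝒦', hne', hbd', hideal⟩, -⟩ := monomialPatchOrderReduction Es hEs hpd 𝒦 hbd h𝒦 hm
  haveI hNt : IsNoetherian t.top := CentreSeq.isNoetherian_top t
  set N := t.transformMarked ⟨monomialSum 𝒦, Es, m⟩ with hN
  -- the centres lie over `Y₀.ι⁻¹ (singGE K m) ⊆ Y₀.ι⁻¹ Z`
  have hS₀ : ((⟨monomialSum 𝒦, Es, m⟩ : MarkedIdeal (Y₀ : Scheme.{u})).support : Set (Y₀ : Scheme.{u})) ⊆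
      Y₀.ι.base ⁻¹' Z := by
    have h := MarkedIdeal.support_comap_of_etale Y₀.ι (⟨K, [], m⟩ : MarkedIdeal Y) Es
    change (⟨K.comap Y₀.ι, Es, m⟩ : MarkedIdeal (Y₀ : Scheme.{u})).support = Y₀.ι.base ⁻¹' singGE K m at h
    rw [hK] at h
    rw [h]
    exact Set.preimage_mono hSZ
  have hover : t.CentresOver (Y₀.ι.base ⁻¹' Z) :=
    CentreSeq.CentresOver.mono t hS₀ (CentreSeq.IsAdmissibleFor.centresOver_support _ _ hadm)
  obtain ⟨E, hE, hET, hEq⟩ := exists_isEffectiveCartier_mul_transformMarked_ideal_of_centresOver t _ _ hadm hover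
  -- the package on `t.top`
  have hfac : (K.comap Y₀.ι).comap t.comp = E * N.ideal := by rw [hK]; exact hEq
  have hordN : ∀ y, Y₀.ι.base (t.comp.base y) ∈ Z → idealOrder N.ideal y < m := fun y _ => by
    have h := idealOrder_lt_of_support_eq_empty N hsupp y
    rwa [hN, CentreSeq.transformMarked_mult] at h
  have hendN : ∀ y ∈ (N.ideal.support : Set t.top), Y₀.ι.base (t.comp.base y) ∈ Z → IsEndNear N.ideal N.boundary y := by
    intro y _ _
    refine ⟨N.boundary, fun F hF => hF, ⊤, trivial, ?_, 𝒦', hbd', hne', by rw [hideal]⟩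
    have h := hsnc'.comap_of_isOpenImmersion (f := (⊤ : t.top.Opens).ι)
    rwa [Scheme.IdealSheafData.comap_top] at h
  -- END and orders of `K` off `Z`
  have hend' : ∀ y ∈ (K.support : Set Y), y ∉ Z → IsEndNear K 𝓛 y := fun y hy _ => hend y hy
  have hord' : ∀ y, y ∉ Z → y ∉ (∅ : Set Y) → idealOrder K y < m := by
    intro y hyZ _
    by_contra hlt
    exact hyZ (hSZ ((MarkedIdeal.mem_support_iff (⟨K, [], m⟩ : MarkedIdeal Y) y).mpr
      ((le_idealOrder_iff K y m).mp (not_lt.mp hlt))))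
  have hZj : Z ⊆ Set.range Y₀.ι.base := by rw [Scheme.Opens.range_ι]; exact hZY₀
  obtain ⟨M', K', 𝓛'', h1, h2, h3, h4, h5, -⟩ := exists_factorization_extend t Y₀.ι hZ hZj hover K 𝓛 m hend' hord'
    E N.ideal N.boundary hfac hE hET hordN hendN
  have hreg' := CentreSeqExtend.allRegular_extend t Y₀.ι hZ hZj hover (CentreSeq.IsAdmissibleFor.allRegular _ _ hadm)
  exact ⟨CentreSeqExtend.extend t Y₀.ι, hreg', CentreSeqExtend.centresOver_extend t Y₀.ι hZ hover,
    CentreSeqExtend.isRegular_top_of_allRegular _ hY hreg', M', K', 𝓛'', h1, h2, h3, fun y => h4 y (fun h => h.elim), h5⟩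

/-! ## §4 The user-facing statement -/

/-- [OURS · L1 W5.2 · F7(β) (β-AX) X3 C-I (G-T) (iv‴)] **END ORDER REDUCTION FOR A PIECEWISE-PRESENTED TOP LOCUS.**  `X` regular Noetherian,
`K` locally END on its cosupport (letters `𝓛₀`), `m ≥ 1`; the top locus `singGE K m` is the disjoint union of finitely many CLOSED
PIECES `P i`, and every piece lies in an open `U` on which `K|_U = Σ 𝒦` is a monomial sum over snc pointed-distinct letters.  THEN the
conclusion of `EndOrderReduction m` holds for `K`: a blow-up sequence with regular centres over `singGE K m`, regular Noetherian top,
`K·𝒪 = M · K₁` with `M` effective Cartier, `ord K₁ < m` everywhere, `K₁` locally END on its cosupport, `cosupp K₁` over `cosupp K`.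
(Bierstone–Milman's sequential chart-by-chart gluing in the regime sound under (H-pt); the residual case (iii′) is not covered.)
[cite: BierstoneMilman2006, Lemma 8.7; proof of Thm. 8.5, Step 1] [cite: GortzWedhorn2020, Prop. 13.91 (1)–(3)] -/
theorem endOrderReduction_of_piecewisePresented [IsNoetherian X] (hX : Scheme.IsRegular X) (K : X.IdealSheafData)
    (𝓛₀ : List X.IdealSheafData) {m : ℕ} (hm : 1 ≤ m) {n : ℕ} (P : Fin n → Closeds X)
    (hdisj : ∀ i k, i ≠ k → Disjoint (P i : Set X) (P k)) (hPK : ∀ i, (P i : Set X) ⊆ singGE K m)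
    (hcov : singGE K m ⊆ ⋃ i, (P i : Set X)) (hend : ∀ x ∈ (K.support : Set X), IsEndNear K 𝓛₀ x)
    (hpres : ∀ i, ∃ (U : X.Opens) (Es : List (U : Scheme.{u}).IdealSheafData) (𝒦 : List (List ((U : Scheme.{u}).IdealSheafData × ℕ))),
      (P i : Set X) ⊆ (U : Set X) ∧ HasSNC Es ∧ PointedDistinct Es ∧ (∀ A ∈ 𝒦, boundaryOf A = Es) ∧ 𝒦 ≠ [] ∧
        K.comap U.ι = monomialSum 𝒦) :
    ∃ s : CentreSeq X, s.AllRegular ∧ s.CentresOver (singGE K m) ∧ Scheme.IsRegular s.top ∧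
      ∃ (_ : IsNoetherian s.top) (M K₁ : s.top.IdealSheafData) (𝓛₁ : List s.top.IdealSheafData),
        K.comap s.comp = M * K₁ ∧ IsEffectiveCartier M ∧ (∀ x : s.top, idealOrder K₁ x < (m : ℕ∞)) ∧
        (∀ x ∈ (K₁.support : Set s.top), IsEndNear K₁ 𝓛₁ x) ∧
        (K₁.support : Set s.top) ⊆ s.comp ⁻¹' (K.support : Set X) := by
  refine endOrderReduction_of_closedPieces hX K 𝓛₀ m P hdisj hPK hcov hend fun i Y _ g _ hPi hgk => ?_
  obtain ⟨U, Es, 𝒦, hPU, hEs, hpd, hbd, h𝒦, hKU⟩ := hpres i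
  haveI : IsLocallyNoetherian (U : Scheme.{u}) := isLocallyNoetherian_of_isOpenImmersion U.ι
  have hY : Scheme.IsRegular Y := fun y => by
    haveI := hX (g.base y)
    exact IsRegularLocalRing.of_ringEquiv (asIso (g.stalkMap y)).commRingCatIsoToRingEquiv
  -- the presentation pulled back to `Y₀ := g⁻¹ U` along `g ∣_ U`
  set Y₀ : Y.Opens := g ⁻¹ᵁ U with hY₀
  have hfacU : (g ∣_ U) ≫ U.ι = Y₀.ι ≫ g := morphismRestrict_ι g U
  have hEs' : HasSNC (Es.map (·.comap (g ∣_ U))) := by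
    have h := hEs.comap_of_isOpenImmersion (f := g ∣_ U)
    rwa [Scheme.IdealSheafData.comap_top] at h
  have hpd' : PointedDistinct (Es.map (·.comap (g ∣_ U))) := pointedDistinct_map_comap_of_flat (g ∣_ U) hEs hpd
  have hbd' : ∀ A ∈ 𝒦.map (fun A => A.map fun p => (p.1.comap (g ∣_ U), p.2)), boundaryOf A = Es.map (·.comap (g ∣_ U)) := by
    intro A hA
    obtain ⟨A₀, hA₀, rfl⟩ := List.mem_map.mp hA
    rw [DepthTargets.boundaryOf_map_comap, hbd A₀ hA₀]
  have h𝒦' : 𝒦.map (fun A => A.map fun p => (p.1.comap (g ∣_ U), p.2)) ≠ [] := by simpa using h𝒦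
  have hK' : (K.comap g).comap Y₀.ι = monomialSum (𝒦.map (fun A => A.map fun p => (p.1.comap (g ∣_ U), p.2))) := by
    rw [← Scheme.IdealSheafData.comap_comp, ← hfacU, Scheme.IdealSheafData.comap_comp, hKU,
      DepthTargets.comap_monomialSum_eq_map]
  -- the piece, seen in `Y`
  have hZ : IsClosed (g.base ⁻¹' (P i : Set X)) := (P i).isClosed.preimage g.continuous
  have hSZ : singGE (K.comap g) m ⊆ g.base ⁻¹' (P i : Set X) := by
    intro y hy
    have h := MarkedIdeal.support_comap_of_etale g (⟨K, [], m⟩ : MarkedIdeal X) []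
    change singGE (K.comap g) m = g.base ⁻¹' singGE K m at h
    rw [h] at hy
    obtain ⟨k, hk⟩ := Set.mem_iUnion.mp (hcov hy)
    by_cases hki : k = i
    · subst hki; exact hk
    · exact absurd hk (Set.disjoint_left.mp (hgk k hki) ⟨y, rfl⟩)
  have hZY₀ : g.base ⁻¹' (P i : Set X) ⊆ (Y₀ : Set Y) := fun y hy => hPU hy
  have hend' : ∀ y ∈ ((K.comap g).support : Set Y), IsEndNear (K.comap g) (𝓛₀.map (·.comap g)) y := fun y hy =>
    (hend (g.base y) ((mem_support_comap_iff g K y).mp hy)).comap_of_isOpenImmersion g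
  obtain ⟨s, hsreg, hsover, hstop, M, K₁, 𝓛', hfac, hM, hMZ, hord, hsend⟩ :=
    endOrderReduction_cure_of_presentation hY (K.comap g) _ hend' hm hZ hSZ Y₀ hZY₀ _ hEs' hpd' _ hbd' h𝒦' hK'
  exact ⟨s, hsreg, hsover, hstop, M, K₁, 𝓛', hfac, hM, hMZ, fun y _ => hord y, fun y hy _ => hsend y hy⟩

end Summit.ResolutionOfSingularities.ResolutionOfSingularities.Theorems.X3LemmaM

end
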